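import Literature.IUT.HodgeTheaters.TemperedGraphGroupDataOfProp36
import Literature.IUT.HodgeTheaters.TemperedCoveringsCor23viHatIncidenceOfSeparatingQuotient
import Literature.AnabelianGeometry.SemiGraphs.TemperedSeparatingQuotientOfCovering
import Literature.AnabelianGeometry.SemiGraphs.TemperedSubgraphThm37Hypotheses
import Literature.AnabelianGeometry.SemiGraphs.TemperedEdgeLikeProofs
import Literature.AnabelianGeometry.SemiGraphs.ThetaRayRefutation
import HarnessLib

/-!
# [IUTchI] Cor. 2.3 (vi): STRONG NON-VACUITY of the pro-`Σ̂` edge–subgraph incidence `hF` — a two-vertex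
# model with an open edge OUTSIDE `ℍ`, where the premise of `hF` is refuted by a separating finite quotient

S. Mochizuki, *Inter-universal Teichmüller theory I: construction of Hodge theaters*, kurims manuscript (May
2020), §2, Cor. 2.3 (vi) p. 48 l. 6–16, proof p. 49 l. 62–64 ("by passing to pro-`Σ` completions")
[cite: Mochizuki2012, Cor 2.3(vi) pp.48-49] (D-0012 claim key; series status DISPUTED; nothing of the series is
asserted here); S. Mochizuki, *Semi-graphs of anabelioids*, Publ. RIMS **42** (2006), Def. 2.1 pp. 22–24
(restriction `𝒢_ℍ`), Def. 3.5 (ii) p. 37 (coverings), Prop. 3.6 (iii) p. 38, Thm. 3.7 (i)/(iii) pp. 40–41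
[cite: MochizukiSemiAnbd2006, Thm 3.7 p.40]; L. Ribes, P. Zalesskii, *Profinite groups*, 2nd ed. (2010),
§3.3 (free pro-`p` groups) [cite: RibesZalesskii2010, §3.3].

PROOF-ONLY file (abc-iut cell, seat abc-iut-L5-d5 gen 9, L5 ROWS #7 row R58 «COR23VI-HF-STRONG-NV» of
abc-iut-L5-lead RULINGS #118 (1); cone row `IUTchI:Cor2.3(vi)`, COUNT-NEUTRAL upgrade of the «WEAK NV» label of
the binder `hF`).  No definition, no instance, no notation, no new `Prop` fact.  Consumed BY NAME, never edited
or restated: abc-iut-w4-d070's separation principle `StableCurveTemperedData.not_map_le_conj_closure_of_openNormal`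
and `….hatEdgeIncidence_of_openNormalSeparating` (p498282); abc-iut-L3-t11's covering bridge
`TemperedPiChart.openNormalSeparating_singleVertex_of_finiteCoverings` (`TemperedSeparatingQuotientOfCovering`);
abc-iut-L3's ray of free pro-`p` groups `thetaRayFreeProP p n` with its UNCONDITIONAL Thm 3.7 hypotheses
(`thetaRayFreeProP_thm37Hypotheses'`), `Thm37Hypotheses.restrictSub`, the characters `χb`, `α`, `θα`
(`χb_α`, `χb_θ`); abc-iut-L5's `TemperedGraphGroupData.exists_completion_of_prop36`.

WHAT WAS OPEN.  abc-iut-w4-d059 reduced the profinite clause of Cor. 2.3 (vi) at the genuine datum to the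
binder `hF` («pro-`Σ̂` edge–subgraph incidence»: for an edge `e`, an edge-like `L ∈ edgeLikeSubgroups c e` and
`g ∈ Π̂_𝔾`, `ι(L) ⊆ g · closure ι(Π^tp_ℍ) · g⁻¹` ⇒ some branch of `e` abuts to a vertex of `ℍ`; GAP G-w4d059-g8-1)
and inhabited `{hF, hdict}` at a ONE-vertex witness (p496799), where `hF` holds «for the one-vertex reason» (its
conclusion is true for every edge): a WEAK non-vacuity (RULINGS #118 (1)).  THIS FILE inhabits `hF` at a carrier
where its conclusion FAILS for an edge, so that its PREMISE must be — and is — refuted by group theory: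

* CARRIER `𝒢₂ := (thetaRayFreeProP p n).restrict ⟨Set.Iic 1, Set.Iic 1⟩` — the restriction ([SemiAnbd] Def. 2.1)
  of abc-iut-L3's ray `𝒢_θ(p, n)` (vertex groups the free pro-`p` group `F̂₂⁽ᵖ⁾ = ⟨a, b⟩`, edge groups `ℤ_p`,
  gluings `β_k⁺ ↦ α : 1 ↦ a`, `β_k⁻ ↦ θ_{n_k} ∘ α : 1 ↦ a·b^{p^{n_k}}`) to its first two vertices: vertices `v₀, v₁`,
  the CLOSED edge `e₀ = [v₀, v₁]` and the edge `e₁`, OPEN at `v₁` (its branch `β₁⁺` abuts to the omitted `v₂`,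
  `restrictRay_abuts_one_true`); connected (`isConnected_restrict`, the 8-node subdivision by hand), hence [SemiAnbd] Thm.
  3.7's hypotheses (`thm37Hypotheses_restrict`).  `ℍ := ⟨{v₀}, ∅⟩`: NO branch of `e₁` abuts to a vertex of `ℍ`.
* SEPARATING COVERING (§1): an open normal `U ⊴ ℤ_p` missing `p^{n_1}`, `N := χ_b⁻¹(U) ⊴ F̂₂⁽ᵖ⁾` (`α(ℤ_p) ≤ N`,
  `a·b^{p^{n_1}} ∉ N`; `exists_separatingSubgroup`), and the FINITE covering `T` of `𝒢₂` with every fibre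
  `F̂₂⁽ᵖ⁾/N`: translation over `v₁`, through `θ_{n_1} ∘ α` over `e₁`, TRIVIAL over `v₀`, `e₀`, identity gluings
  (`α(t) ∈ N` acts trivially) — `exists_separatingCover`: `Π_{v₀}` fixes `T_{v₀}`, `1 ∈ ℤ_p = Π_{e₁}` moves the
  point `N ∈ T_{e₁}`; whence abc-iut-L3-t11's bridge yields abc-iut-w4-d070's tempered-level binder `hsep`.
* ASSEMBLY (§2): **`hatEdgeIncidence_strong_restrict`** — for EVERY chart `c` of `𝒢₂`, EVERY `h36`, EVERY
  `Π^tp_ℍ ∈ decompSubgroups c ℍ`: (a) `ι(L) ⊄ g · closure ι(Π^tp_ℍ) · g⁻¹` for every edge-like `L` at `e₁` and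
  every `g ∈ Π̂_𝔾` (THE completion of `exists_completion_of_prop36`), and (b) `hF` VERBATIM in abc-iut-w4-d059's
  shape at `(c, ι, Π^tp_ℍ, ℍ)`.  (The `∃`-packaged datum — two DISTINCT vertices, `e₁` open and abutting `v₁ ∉ ℍ`
  only, `decompSubgroups c ℍ` and `edgeLikeSubgroups c e₁` NONEMPTY, (a), (b) — is the sequel file
  `TemperedCoveringsCor23viHatIncidenceStrongNVDatum.lean`.)

## BINDER CENSUS TABLE (L5-lead RULINGS #101 (2) format)

| binder | class | what it is |
|---|---|---|
| `p`, `n` | DATA | the prime and the twist exponents of abc-iut-L3's ray `𝒢_θ(p, n)` (any) |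
| `c : TemperedPiChart 𝒢₂`, `h36` | DATA / DATUM-INTERNAL | ANY chart of `π₁^temp(𝒢₂)`; `h36` names `ι` |
| `TpH`, `hTpH : TpH ∈ decompSubgroups c ℍ` | DATA | the subgroup `Π^tp_ℍ` of `hF` (any; the family is nonempty) |
| `v₀`, `hv₀`, `e₁`, `he₁` | DATA (bookkeeping) | the vertex of index `0` / edge of index `1` of the restriction |

COUNTS: LAW 0 · FACT 0 · ORIGIN 0 — everything is PROVED for the model.  HONEST LIMITS: a MODEL datum (L3's ray
restricted), not the special fibre of any curve; `hF` is NOT thereby proved at any genuine special fibre (it stays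
GAP G-w4d059-g8-1, cf. abc-iut-w4-d070's conjugacy-separation reading); consistency evidence for OUR binder only.
Nothing here bears on [IUTchIII] Cor. 3.12; typed ≠ inhabited ≠ discharged; nothing asserts abc proved or refuted.
-/

noncomputable section

namespace Literature.IUT.HodgeTheaters

open CategoryTheory _root_.Topology
open scoped Pointwise
open Literature.AnabelianGeometry.SemiGraphs
open Literature.AnabelianGeometry.SemiGraphs.ProfiniteSemiGraph

universe u

namespace StrongHatEdgeIncidenceNV

open FreeProPRankTwo Multiplicative

/-! ### 1. The model: L3's ray `𝒢_θ(p, n)` restricted to `{v₀, v₁; e₀, e₁}`, and the separating covering -/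

section Model

variable (p : ℕ) [hp : Fact p.Prime] (n : ℕ → ℕ)

/-- `ρ 1 x = x` for a `Π`-set. [folklore] -/
private theorem ρ_one_apply {G : Type u} [Group G] (X : Action (Type u) G) (x : X.V) : X.ρ 1 x = x := by
  rw [map_one]; rfl

/-- In the restriction `{v₀, v₁; e₀, e₁}` of the ray a branch `(k, c)` abuts to `v` iff it does so in the ray.
[cite: MochizukiSemiAnbd2006, §1 p.12] -/
theorem restrictRay_abuts_iff (b : (⟨Set.Iic 1, Set.Iic 1⟩ : SemiGraph.ray.Subgraph).toSemiGraph.Branch)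
    (v : (⟨Set.Iic 1, Set.Iic 1⟩ : SemiGraph.ray.Subgraph).toSemiGraph.Vertex) :
    (⟨Set.Iic 1, Set.Iic 1⟩ : SemiGraph.ray.Subgraph).toSemiGraph.abuts b = some v ↔
      (if b.1.2 then b.1.1 + 1 else b.1.1) = v.1 := by
  rw [SemiGraph.Subgraph.abuts_eq_some_iff, SemiGraph.ray_abuts, Option.some.injEq]

/-- The branch `β₁⁺ = (1, true)` of `e₁` abuts to NO vertex of the restriction (its vertex `v₂` is omitted):
`e₁` is an open edge there. [cite: MochizukiSemiAnbd2006, §1 p.12] -/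
theorem restrictRay_abuts_one_true (h : ((1, true) : ℕ × Bool).1 ∈ Set.Iic 1) :
    (⟨Set.Iic 1, Set.Iic 1⟩ : SemiGraph.ray.Subgraph).toSemiGraph.abuts ⟨(1, true), h⟩ = none := by
  cases hb : (⟨Set.Iic 1, Set.Iic 1⟩ : SemiGraph.ray.Subgraph).toSemiGraph.abuts ⟨(1, true), h⟩ with
  | none => rfl
  | some v =>
    have := (restrictRay_abuts_iff ⟨(1, true), h⟩ v).mp hb
    have hv := v.2
    simp only [Set.mem_Iic] at hv
    simp only [ite_true] at this
    omega

/-- **The restriction of the ray to `{v₀, v₁; e₀, e₁}` is connected**: the path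
`v₀ — β₀⁻ — e₀ — β₀⁺ — v₁ — β₁⁻ — e₁ — β₁⁺` of its barycentric subdivision passes through every point.
[cite: MochizukiSemiAnbd2006, §1 pp.11-13] -/
private theorem isConnected_restrict :
    ((thetaRayFreeProP p n).restrict (⟨Set.Iic (1 : ℕ), Set.Iic (1 : ℕ)⟩ : SemiGraph.ray.Subgraph)).IsConnected := by
  have h0 : (0 : ℕ) ∈ Set.Iic (1 : ℕ) := Set.mem_Iic.mpr (Nat.zero_le 1)
  have h1 : (1 : ℕ) ∈ Set.Iic (1 : ℕ) := Set.mem_Iic.mpr le_rfl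
  let H : SemiGraph.ray.Subgraph := ⟨Set.Iic 1, Set.Iic 1⟩
  let G := H.toSemiGraph
  -- the seven adjacencies of the path
  have a1 : G.subdivision.Adj (Sum.inr (Sum.inr ⟨(0, false), h0⟩)) (Sum.inl ⟨0, h0⟩) :=
    G.subdivision_adj_of_nodeRel (SemiGraph.NodeRel.branch_vertex _ _ ((restrictRay_abuts_iff _ _).mpr rfl))
  have a2 : G.subdivision.Adj (Sum.inr (Sum.inl ⟨0, h0⟩)) (Sum.inr (Sum.inr ⟨(0, false), h0⟩)) :=
    G.subdivision_adj_of_nodeRel (SemiGraph.NodeRel.edge_branch (G := G) ⟨(0, false), h0⟩)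
  have a3 : G.subdivision.Adj (Sum.inr (Sum.inl ⟨0, h0⟩)) (Sum.inr (Sum.inr ⟨(0, true), h0⟩)) :=
    G.subdivision_adj_of_nodeRel (SemiGraph.NodeRel.edge_branch (G := G) ⟨(0, true), h0⟩)
  have a4 : G.subdivision.Adj (Sum.inr (Sum.inr ⟨(0, true), h0⟩)) (Sum.inl ⟨1, h1⟩) :=
    G.subdivision_adj_of_nodeRel (SemiGraph.NodeRel.branch_vertex _ _ ((restrictRay_abuts_iff _ _).mpr rfl))
  have a5 : G.subdivision.Adj (Sum.inr (Sum.inr ⟨(1, false), h1⟩)) (Sum.inl ⟨1, h1⟩) :=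
    G.subdivision_adj_of_nodeRel (SemiGraph.NodeRel.branch_vertex _ _ ((restrictRay_abuts_iff _ _).mpr rfl))
  have a6 : G.subdivision.Adj (Sum.inr (Sum.inl ⟨1, h1⟩)) (Sum.inr (Sum.inr ⟨(1, false), h1⟩)) :=
    G.subdivision_adj_of_nodeRel (SemiGraph.NodeRel.edge_branch (G := G) ⟨(1, false), h1⟩)
  have a7 : G.subdivision.Adj (Sum.inr (Sum.inl ⟨1, h1⟩)) (Sum.inr (Sum.inr ⟨(1, true), h1⟩)) :=
    G.subdivision_adj_of_nodeRel (SemiGraph.NodeRel.edge_branch (G := G) ⟨(1, true), h1⟩)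
  -- reachability of every node from `v₀`
  have rv1 : G.subdivision.Reachable (Sum.inl ⟨0, h0⟩) (Sum.inl ⟨1, h1⟩) :=
    ((a1.symm.reachable.trans a2.symm.reachable).trans a3.reachable).trans a4.reachable
  have re1 : G.subdivision.Reachable (Sum.inl ⟨0, h0⟩) (Sum.inr (Sum.inl ⟨1, h1⟩)) :=
    (rv1.trans a5.symm.reachable).trans a6.symm.reachable
  have reach : ∀ x : G.Node, G.subdivision.Reachable (Sum.inl ⟨0, h0⟩) x := by
    rintro (⟨k, hk⟩ | ⟨k, hk⟩ | ⟨⟨k, c⟩, hk⟩)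
    · have hk' : k ≤ 1 := hk
      interval_cases k
      · exact SimpleGraph.Reachable.refl _
      · exact rv1
    · have hk' : k ≤ 1 := hk
      interval_cases k
      · exact a1.symm.reachable.trans a2.symm.reachable
      · exact re1
    · have hk' : k ≤ 1 := hk
      interval_cases k <;> cases c
      · exact a1.symm.reachable
      · exact (a1.symm.reachable.trans a2.symm.reachable).trans a3.reachable
      · exact rv1.trans a5.symm.reachable
      · exact re1.trans a7.reachable
  let x₀ : G.Node := Sum.inl ⟨0, h0⟩
  exact ⟨@SimpleGraph.Connected.mk _ _ (fun x y => (reach x).symm.trans (reach y)) ⟨x₀⟩⟩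

/-- The restriction of `𝒢_θ(p, n)` to `{v₀, v₁; e₀, e₁}` satisfies the hypotheses of [SemiAnbd] Thm. 3.7
(abc-iut-L3's UNCONDITIONAL `thetaRayFreeProP_thm37Hypotheses'`, restricted to a connected sub-semi-graph with
a vertex by `Thm37Hypotheses.restrictSub`). [cite: MochizukiSemiAnbd2006, Thm 3.7 p.40] -/
theorem thm37Hypotheses_restrict :
    ((thetaRayFreeProP p n).restrict (⟨Set.Iic (1 : ℕ), Set.Iic (1 : ℕ)⟩ : SemiGraph.ray.Subgraph)).Thm37Hypotheses :=
  (thetaRayFreeProP_thm37Hypotheses' p n).restrictSub _ (isConnected_restrict p n)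
    (hasVertex_restrict_of_mem (𝒢 := thetaRayFreeProP p n)
      (H := (⟨Set.Iic (1 : ℕ), Set.Iic (1 : ℕ)⟩ : SemiGraph.ray.Subgraph)) (v := (0 : ℕ))
      (Set.mem_Iic.mpr (Nat.zero_le 1) : (0 : ℕ) ∈ Set.Iic (1 : ℕ)))

/-- The branch homomorphisms of the restriction are those of the ray: `β_k⁺ ↦ α`, `β_k⁻ ↦ θ_{n_k} ∘ α`
(definitional). [cite: MochizukiSemiAnbd2006, Def 2.1 p.24] -/
private theorem brHom_restrict (b : (⟨Set.Iic (1 : ℕ), Set.Iic (1 : ℕ)⟩ : SemiGraph.ray.Subgraph).toSemiGraph.Branch)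
    (v : (⟨Set.Iic (1 : ℕ), Set.Iic (1 : ℕ)⟩ : SemiGraph.ray.Subgraph).toSemiGraph.Vertex)
    (h : (⟨Set.Iic (1 : ℕ), Set.Iic (1 : ℕ)⟩ : SemiGraph.ray.Subgraph).toSemiGraph.abuts b = some v) :
    ((thetaRayFreeProP p n).restrict (⟨Set.Iic (1 : ℕ), Set.Iic (1 : ℕ)⟩ : SemiGraph.ray.Subgraph)).brHom b v h =
      if b.1.2 then α p else θα p (n b.1.1) := rfl

/-- **The separating subgroup**: `N := χ_b⁻¹(U)` for an open normal `U ⊴ ℤ_p` missing `p^{n_1}` contains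
`α(ℤ_p) = ⟨a⟩‾` (`χ_b(α(t)) = 0`) but not `(θ_{n_1} ∘ α)(1) = a·b^{p^{n_1}}` (`χ_b = p^{n_1} ≠ 0`).
[cite: RibesZalesskii2010, §3.3] -/
theorem exists_separatingSubgroup : ∃ N : OpenNormalSubgroup (Grp p), (∀ t, α p t ∈ N.toSubgroup) ∧
    θα p (n 1) (ofAdd 1) ∉ N.toSubgroup := by
  classical
  have ht₁ : (ofAdd ((p : ℤ_[p]) ^ n 1) : Multiplicative ℤ_[p]) ≠ 1 := by
    rw [Ne, ← ofAdd_zero, Equiv.apply_eq_iff_eq]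
    exact pow_ne_zero _ (Nat.cast_ne_zero.mpr hp.out.ne_zero)
  obtain ⟨U, hU⟩ := ProfiniteGrp.exist_openNormalSubgroup_sub_open_nhds_of_one
    (isOpen_compl_singleton (x := (ofAdd ((p : ℤ_[p]) ^ n 1) : Multiplicative ℤ_[p])))
    (by simpa using ht₁.symm)
  have ht₁U : (ofAdd ((p : ℤ_[p]) ^ n 1) : Multiplicative ℤ_[p]) ∉ (U : Set (Multiplicative ℤ_[p])) :=
    fun h => hU h rfl
  have hopen : IsOpen ((U.toSubgroup.comap (χb p).toMonoidHom : Subgroup (Grp p)) : Set (Grp p)) :=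
    U.isOpen.preimage (χb p).continuous
  refine ⟨⟨⟨U.toSubgroup.comap (χb p).toMonoidHom, hopen⟩, inferInstance⟩, fun t => ?_, fun h => ht₁U ?_⟩
  · show χb p (α p t) ∈ U.toSubgroup
    rw [χb_α]
    exact U.toSubgroup.one_mem
  · have h' : χb p (θα p (n 1) (ofAdd 1)) ∈ U.toSubgroup := h
    rw [θα_apply, α_ofAdd_one, χb_θ, χb_a, χa_a, toAdd_one, toAdd_ofAdd, zero_add, mul_one] at h'
    exact h'

/-- **The separating finite covering.**  For an open normal `N ⊴ F̂₂⁽ᵖ⁾` containing `α(ℤ_p)` and missing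
`a·b^{p^{n_1}}`, the data «`F̂₂⁽ᵖ⁾/N` over `v₁` (left translation) and over `e₁` (through `θ_{n_1} ∘ α`), the SAME
finite set with the TRIVIAL action over `v₀` and `e₀`, identity gluings» is a finite covering of the restriction
([SemiAnbd] Def. 3.5 (i): an object of `B^cov`); `Π_{v₀}` acts trivially on its `v₀`-constituent and
`1 ∈ ℤ_p = Π_{e₁}` moves the point `N` of its `e₁`-constituent. [cite: MochizukiSemiAnbd2006, Def 3.5(i) p.37] -/
theorem exists_separatingCover (N : OpenNormalSubgroup (Grp p)) (hαN : ∀ t, α p t ∈ N.toSubgroup)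
    (hθN : θα p (n 1) (ofAdd 1) ∉ N.toSubgroup)
    (v₀ : (⟨Set.Iic (1 : ℕ), Set.Iic (1 : ℕ)⟩ : SemiGraph.ray.Subgraph).toSemiGraph.Vertex) (hv₀ : v₀.1 = 0)
    (e₁ : (⟨Set.Iic (1 : ℕ), Set.Iic (1 : ℕ)⟩ : SemiGraph.ray.Subgraph).toSemiGraph.Edge) (he₁ : e₁.1 = 1) :
    ∃ S : CovObj ((thetaRayFreeProP p n).restrict (⟨Set.Iic (1 : ℕ), Set.Iic (1 : ℕ)⟩ : SemiGraph.ray.Subgraph)),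
      S.IsFinite ∧ (∀ (γ : Grp p) (s : (S.SV v₀).obj.V), (S.SV v₀).obj.ρ γ s = s) ∧
      ∃ (γ : Multiplicative ℤ_[p]) (s : (S.SE e₁).obj.V), (S.SE e₁).obj.ρ γ s ≠ s := by
  classical
  -- the finite quotient `F̂₂⁽ᵖ⁾/N` as an object of `B^temp(F̂₂⁽ᵖ⁾)`
  let Tq : BTemp (Grp p) := ⟨Action.ofMulAction (Grp p) (Grp p ⧸ N.toSubgroup),
    (temperedAction_quotient_iff IsTempered.of_profinite N.toSubgroup).mpr N.isOpen⟩
  haveI hfin : Finite (Grp p ⧸ N.toSubgroup) := Subgroup.quotient_finite_of_isOpen _ N.isOpen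
  -- the twisting homomorphisms: trivial at `v₀`, `e₀`; identity at `v₁`; `θ_{n_1} ∘ α` at `e₁`
  let ηV : ∀ v : (⟨Set.Iic (1 : ℕ), Set.Iic (1 : ℕ)⟩ : SemiGraph.ray.Subgraph).toSemiGraph.Vertex,
      ((thetaRayFreeProP p n).restrict (⟨Set.Iic (1 : ℕ), Set.Iic (1 : ℕ)⟩ : SemiGraph.ray.Subgraph)).Gv v →ₜ*
        Grp p := fun v => if v.1 = 0 then 1 else (ContinuousMonoidHom.id (Grp p) : Grp p →ₜ* Grp p)
  let ηE : ∀ e : (⟨Set.Iic (1 : ℕ), Set.Iic (1 : ℕ)⟩ : SemiGraph.ray.Subgraph).toSemiGraph.Edge,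
      ((thetaRayFreeProP p n).restrict (⟨Set.Iic (1 : ℕ), Set.Iic (1 : ℕ)⟩ : SemiGraph.ray.Subgraph)).Ge e →ₜ*
        Grp p := fun e => if e.1 = 0 then 1 else θα p (n 1)
  have hV0 : ∀ v, v.1 = 0 → ηV v = 1 := fun v h => if_pos h
  have hV1 : ∀ v, v.1 = 1 → ηV v = ContinuousMonoidHom.id (Grp p) := fun v h =>
    if_neg (by rw [h]; exact Nat.one_ne_zero)
  have hE0 : ∀ e, e.1 = 0 → ηE e = 1 := fun e h => if_pos h
  have hE1 : ∀ e, e.1 = 1 → ηE e = θα p (n 1) := fun e h => if_neg (by rw [h]; exact Nat.one_ne_zero)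
  -- `N` acts trivially on `F̂₂⁽ᵖ⁾/N`
  have hNtriv : ∀ g ∈ N.toSubgroup, ∀ q : Grp p ⧸ N.toSubgroup, g • q = q := by
    intro g hg q
    induction q using QuotientGroup.induction_on with
    | H x =>
      rw [MulAction.Quotient.smul_mk, smul_eq_mul, QuotientGroup.mk_mul, (QuotientGroup.eq_one_iff g).mpr hg,
        one_mul]
  -- compatibility of the twists along the three abutting branches
  have hcompat : ∀ (b : (⟨Set.Iic (1 : ℕ), Set.Iic (1 : ℕ)⟩ : SemiGraph.ray.Subgraph).toSemiGraph.Branch)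
      (v : (⟨Set.Iic (1 : ℕ), Set.Iic (1 : ℕ)⟩ : SemiGraph.ray.Subgraph).toSemiGraph.Vertex)
      (h : (⟨Set.Iic (1 : ℕ), Set.Iic (1 : ℕ)⟩ : SemiGraph.ray.Subgraph).toSemiGraph.abuts b = some v)
      (t : Multiplicative ℤ_[p]) (q : Grp p ⧸ N.toSubgroup),
      ηE ((⟨Set.Iic (1 : ℕ), Set.Iic (1 : ℕ)⟩ : SemiGraph.ray.Subgraph).toSemiGraph.edgeOf b) t • q =
        ηV v (((thetaRayFreeProP p n).restrict
          (⟨Set.Iic (1 : ℕ), Set.Iic (1 : ℕ)⟩ : SemiGraph.ray.Subgraph)).brHom b v h t) • q := by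
    intro b v h t q
    have hb := (restrictRay_abuts_iff b v).mp h
    rw [brHom_restrict]
    obtain ⟨⟨k, c⟩, hk⟩ := b
    obtain ⟨m, hm⟩ := v
    have hk1 : k ≤ 1 := hk
    have hm1 : @LE.le ℕ _ m 1 := hm  -- `m : ray.Vertex`; the bound over `ℕ` for `omega`
    change ηE ⟨k, hk⟩ t • q = ηV ⟨m, hm⟩ ((if c then α p else θα p (n k)) t) • q
    cases c
    · -- `β_k⁻ : e_k → v_k`, glued by `θ_{n_k} ∘ α`
      simp only [Bool.false_eq_true, ite_false] at hb ⊢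
      subst hb
      interval_cases k
      · rw [hE0 _ rfl, hV0 _ rfl]; rfl
      · rw [hE1 _ rfl, hV1 _ rfl]; rfl
    · -- `β_0⁺ : e_0 → v_1`, glued by `α`, whose image lies in `N`
      have hb' : k + 1 = m := by simpa using hb
      obtain rfl : m = k + 1 := hb'.symm
      obtain rfl : k = 0 := by omega
      rw [if_pos (rfl : true = true), hE0 _ rfl, hV1 _ rfl]
      change (1 : Grp p) • q = α p t • q
      rw [one_smul, hNtriv _ (hαN t)]
  -- the covering
  let T : CovObj ((thetaRayFreeProP p n).restrict (⟨Set.Iic (1 : ℕ), Set.Iic (1 : ℕ)⟩ : SemiGraph.ray.Subgraph)) :=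
    { SV := fun v => (BTemp.res (ηV v)).obj Tq
      SE := fun e => (BTemp.res (ηE e)).obj Tq
      glue := fun b v h => BTemp.isoOfEquiv (Equiv.refl _) fun t q => hcompat b v h t q }
  refine ⟨T, ⟨fun _ => hfin, fun _ => hfin⟩, ?_, ?_⟩
  · -- `Π_{v₀}` acts trivially
    intro γ s
    change Tq.obj.ρ (ηV v₀ γ) s = s
    rw [hV0 _ hv₀]
    exact ρ_one_apply Tq.obj s
  · -- `1 ∈ ℤ_p` moves the point `N` over `e₁`
    refine ⟨ofAdd 1, ((1 : Grp p) : Grp p ⧸ N.toSubgroup), fun h => hθN ?_⟩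
    have h' : θα p (n 1) (ofAdd 1) • ((1 : Grp p) : Grp p ⧸ N.toSubgroup) =
        ((1 : Grp p) : Grp p ⧸ N.toSubgroup) := by
      rw [← hE1 _ he₁]
      exact h
    rw [MulAction.Quotient.smul_mk, smul_eq_mul, mul_one, QuotientGroup.mk_one, QuotientGroup.eq_one_iff] at h'
    exact h'

end Model

/-! ### 2. STRONG non-vacuity of `hF`: its conclusion FAILS at the open edge `e₁`, and its premise is refuted
by the separating finite quotient -/

section Strong

variable (p : ℕ) [hp : Fact p.Prime] (n : ℕ → ℕ)

/-- **`hF` at the two-vertex model, STRONG form.**  For the restriction `𝒢₂` of abc-iut-L3's `𝒢_θ(p, n)` to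
`{v₀, v₁; e₀, e₁}` (two vertices, `e₀` closed, `e₁` OPEN at `v₁`), EVERY chart `c` of `π₁^temp(𝒢₂)`, EVERY
`h36`, the sub-semi-graph `ℍ := {v₀}` and EVERY decomposition subgroup `Π^tp_ℍ ∈ decompSubgroups c ℍ`:
(a) for every edge-like subgroup `L` of the open edge `e₁` and every `g ∈ Π̂_𝔾` (THE completion of
`exists_completion_of_prop36`), `ι(L) ⊄ g · closure ι(Π^tp_ℍ) · g⁻¹` — although NO branch of `e₁` abuts to a
vertex of `ℍ` (abc-iut-L3-t11's `hsep` from `exists_separatingCover`, then abc-iut-w4-d070's separation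
principle in the completion, p498282); (b) hence abc-iut-w4-d059's hypothesis `hF` holds at `(c, ι, Π^tp_ℍ, ℍ)`
for EVERY edge `e` (p498282's `hatEdgeIncidence_of_openNormalSeparating`) — at `e₁` because its premise is
refuted, at `e₀` because `β₀⁻` abuts to `v₀`.  Consistency evidence for OUR binder at a datum with two vertices
and an open edge outside `ℍ`; `hF` (GAP G-w4d059-g8-1) is NOT thereby proved at any genuine special fibre.
[cite: Mochizuki2012, Cor 2.3(vi) p.48] [claim: Mochizuki2012, status: disputed] -/
theorem hatEdgeIncidence_strong_restrict
    (v₀ : (⟨Set.Iic (1 : ℕ), Set.Iic (1 : ℕ)⟩ : SemiGraph.ray.Subgraph).toSemiGraph.Vertex) (hv₀ : v₀.1 = 0)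
    (e₁ : (⟨Set.Iic (1 : ℕ), Set.Iic (1 : ℕ)⟩ : SemiGraph.ray.Subgraph).toSemiGraph.Edge) (he₁ : e₁.1 = 1)
    (c : TemperedPiChart
      ((thetaRayFreeProP p n).restrict (⟨Set.Iic (1 : ℕ), Set.Iic (1 : ℕ)⟩ : SemiGraph.ray.Subgraph)))
    (h36 : ((thetaRayFreeProP p n).restrict
      (⟨Set.Iic (1 : ℕ), Set.Iic (1 : ℕ)⟩ : SemiGraph.ray.Subgraph)).Prop36Hypotheses)
    (TpH : Subgroup c.G) (hTpH : TpH ∈ c.decompSubgroups (⟨{v₀}, ∅⟩ : ((thetaRayFreeProP p n).restrict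
      (⟨Set.Iic (1 : ℕ), Set.Iic (1 : ℕ)⟩ : SemiGraph.ray.Subgraph)).graph.Subgraph)) :
    (∀ L ∈ edgeLikeSubgroups c e₁,
      ∀ g : (TemperedGraphGroupData.exists_completion_of_prop36 _ h36 c).choose,
        ¬ L.map (TemperedGraphGroupData.exists_completion_of_prop36 _ h36 c).choose_spec.choose.toMonoidHom ≤
          MulAut.conj g • (TpH.map (TemperedGraphGroupData.exists_completion_of_prop36 _ h36
            c).choose_spec.choose.toMonoidHom).topologicalClosure) ∧
    (∀ (e : (⟨Set.Iic (1 : ℕ), Set.Iic (1 : ℕ)⟩ : SemiGraph.ray.Subgraph).toSemiGraph.Edge),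
      ∀ L ∈ edgeLikeSubgroups c e, ∀ g : (TemperedGraphGroupData.exists_completion_of_prop36 _ h36 c).choose,
        L.map (TemperedGraphGroupData.exists_completion_of_prop36 _ h36 c).choose_spec.choose.toMonoidHom ≤
          MulAut.conj g • (TpH.map (TemperedGraphGroupData.exists_completion_of_prop36 _ h36
            c).choose_spec.choose.toMonoidHom).topologicalClosure →
        ∃ b : (⟨Set.Iic (1 : ℕ), Set.Iic (1 : ℕ)⟩ : SemiGraph.ray.Subgraph).toSemiGraph.Branch,
          (⟨Set.Iic (1 : ℕ), Set.Iic (1 : ℕ)⟩ : SemiGraph.ray.Subgraph).toSemiGraph.edgeOf b = e ∧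
          ∃ w ∈ (⟨{v₀}, ∅⟩ : ((thetaRayFreeProP p n).restrict
              (⟨Set.Iic (1 : ℕ), Set.Iic (1 : ℕ)⟩ : SemiGraph.ray.Subgraph)).graph.Subgraph).verts,
            (⟨Set.Iic (1 : ℕ), Set.Iic (1 : ℕ)⟩ : SemiGraph.ray.Subgraph).toSemiGraph.abuts b = some w) := by
  -- abc-iut-L3-t11's tempered-level separation binder `hsep` at `ℍ = {v₀}` from ONE finite covering per edge
  -- not abutting `v₀`: only `e₁` qualifies (`β₀⁻` of `e₀` abuts `v₀`), and there the separating covering serves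
  obtain ⟨N, hαN, hθN⟩ := exists_separatingSubgroup p n
  have hsep := TemperedPiChart.openNormalSeparating_singleVertex_of_finiteCoverings h36 c v₀ TpH hTpH (by
    intro e hne
    obtain ⟨k, hk⟩ := e
    have hk1 : @LE.le ℕ _ k 1 := hk
    rcases Nat.le_one_iff_eq_zero_or_eq_one.mp hk1 with hk0 | hk0 <;> subst hk0
    · exact absurd ⟨⟨(0, false), hk⟩, rfl, v₀, rfl, (restrictRay_abuts_iff _ _).mpr (by
        simp only [Bool.false_eq_true, ite_false]; exact hv₀.symm)⟩ hne
    · obtain ⟨m, hm⟩ := e₁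
      have hm1 : m = 1 := he₁
      subst hm1
      exact exists_separatingCover p n N hαN hθN v₀ hv₀ ⟨1, hk⟩ rfl)
  have hι := (TemperedGraphGroupData.exists_completion_of_prop36 _ h36 c).choose_spec.choose_spec.1
  refine ⟨fun L hL g => ?_, StableCurveTemperedData.hatEdgeIncidence_of_openNormalSeparating c hι _ TpH hsep⟩
  -- (a): no branch of `e₁` abuts `v₀`; separate `L` from `Π^tp_ℍ` by `hsep`, then pass to the completion
  have hne₁ : ¬ ∃ b : (⟨Set.Iic (1 : ℕ), Set.Iic (1 : ℕ)⟩ : SemiGraph.ray.Subgraph).toSemiGraph.Branch,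
      (⟨Set.Iic (1 : ℕ), Set.Iic (1 : ℕ)⟩ : SemiGraph.ray.Subgraph).toSemiGraph.edgeOf b = e₁ ∧
        ∃ w ∈ (⟨{v₀}, ∅⟩ : ((thetaRayFreeProP p n).restrict
            (⟨Set.Iic (1 : ℕ), Set.Iic (1 : ℕ)⟩ : SemiGraph.ray.Subgraph)).graph.Subgraph).verts,
          (⟨Set.Iic (1 : ℕ), Set.Iic (1 : ℕ)⟩ : SemiGraph.ray.Subgraph).toSemiGraph.abuts b = some w := by
    rintro ⟨⟨⟨k, c'⟩, hk⟩, hb, w, hw, habs⟩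
    have hk' : k = e₁.1 := congrArg Subtype.val hb
    rw [he₁] at hk'
    subst hk'
    have hw' : w = v₀ := hw
    rw [hw'] at habs
    have h0 : @Eq ℕ v₀.1 0 := hv₀
    have := (restrictRay_abuts_iff _ _).mp habs
    cases c'
    · simp only [Bool.false_eq_true, ite_false] at this; omega
    · simp only [ite_true] at this; omega
  obtain ⟨U, hU, hT, hLU⟩ := hsep e₁ hne₁ L hL
  exact StableCurveTemperedData.not_map_le_conj_closure_of_openNormal c hι U hU hT hLU g

end Strong


end StrongHatEdgeIncidenceNV

end Literature.IUT.HodgeTheaters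

end
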